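import Literature.Computability.AlgebraicComplexity.MS08StableAdmissibility
import Literature.Computability.AlgebraicComplexity.CoordRepRational
import Literature.Computability.AlgebraicComplexity.SLOrbitMapQuotient
import Mathlib.LinearAlgebra.Dual.Lemmas
import HarnessLib

/-!
# GCT II, Prop. 5.2 and Thm. 1.8 (a) from the orbit-map quotient theorem
# (Mulmuley–Sohoni 2008, §5: every `G_v̂`-admissible irreducible occurs in `R_V[v]`)

Companion (THEOREMS ONLY: no definition, no named fact; D-0026) of
`MS08Obstructions.lean` (the named fact `MS08_thm_1_8a`, GCT II Thm. 1.8 (a), main.tex L478–487)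
and `MS08StableAdmissibility.lean` (its «only if» half `MS08_thm_1_8a_mp`, Prop. 5.1, Matsushima for
forms). Here the «if» half — **Prop. 5.2** (main.tex L1119–1123: «Suppose `h ∈ P(V)` is stable. Then
every `H`-admissible, irreducible `G`-module occurs in `R[h]`») — is proved from the ONE classical
ingredient its printed proof cites and the tree lacks, the orbit-map quotient theorem «the orbit
`G ĥ ⊆ V` is affine and isomorphic to `G/H` [mumford]» (L1128–1129), vendored as the named fact
`Grosshans1997_thm_1_11_slOrbit_forms` (`SLOrbitMapQuotient.lean`: Borel Prop. 6.7 /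
Grosshans Thm. 1.11 / Springer Thm. 5.5.5, characteristic `0`, special case `SL_σ(ℂ)` on forms).
The rest of the printed proof (algebraic Peter–Weyl `ℂ[G/H] = ⊕_S S ⊗ (S^*)^H`, L1130–1150, and
«there is a `G`-equivariant surjection from `R[h]` to `ℂ[G ĥ] = ℂ[G/H]` … every irreducible
`G`-module that occurs in `ℂ[G/H]` must occur in `R[h]`», L1159–1168) is replaced by its
elementary core, proved here:

* § 1 (coinvariants) `exists_invariant_functional_of_invariant` — on the completely reducible
  `H`-module `V` (Matsushima for forms, `isSemisimpleRepresentation_comp_stabilizer_of_isPolystable`)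
  a non-zero `H`-invariant vector yields a non-zero `H`-invariant functional `u'` (project onto the
  invariants along a stable complement).
* § 2 (matrix coefficients) the functions `c_x : g ↦ u'(ρ(g)⁻¹ x)` on `SL_σ(ℂ)` are polynomial in
  the matrix entries (`IsRationalRep` + `g⁻¹ = adj g` on `SL`), right-invariant under
  `H = SL ∩ G_v̂`, and `x ↦ c_x` is `SL`-equivariant for left translation and injective — the
  embedding `S ↪ S ⊗ (S^*)^H ⊆ ℂ[G/H]` of the Peter–Weyl decomposition.
* § 3 (the quotient theorem, as a hypothesis) each `c_x` is `g ↦ F_x(g · v)` for a polynomial `F_x`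
  on `Sym^m`; by finite-dimensionality all `F_x` may be taken of degree `≤ D`; the `SL`-module
  `ℂ[Sym^m]_{≤D}` is completely reducible (`isRationalRep_coordRep` + the tree's
  `AlgebraicGroups.isSemisimpleRepresentation_specialLinear`), so the kernel of
  `F ↦ (g ↦ F(g·v))` on it has a stable complement, which yields an EQUIVARIANT lift
  `L : V → ℂ[Sym^m]_{≤D}` of `x ↦ c_x`; some homogeneous component of `L` gives a non-zero
  `SL`-intertwiner `V → ℂ[Δ[v]]_d` («occurs in `R[v]_d`»).
* § 4 `MS08_prop_5_2_of_orbitQuotient`, **`MS08_thm_1_8a_of_orbitQuotient :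
  Grosshans1997_thm_1_11_slOrbit_forms → MS08_thm_1_8a`** (with `MS08_thm_1_8a_of_prop_5_2`).

Honest framing: the named fact `MS08_thm_1_8a` is thereby REDUCED BY THEOREM to one textbook fact
of algebraic group theory; it is not discharged. Nothing here bears on VP versus VNP.

## References

* [MulmuleySohoniGCT2SIAM2008] K. D. Mulmuley, M. Sohoni, *Geometric complexity theory II*, SIAM
  J. Comput. 38 (2008): Thm. 1.8 (a), Props. 5.1–5.2 (arXiv cs/0612134 Thm. 2.8 (a), Props.
  6.1–6.2; main.tex L478–487, L1099–1174).
* [Grosshans1997] F. D. Grosshans, *Algebraic Homogeneous Spaces and Invariant Theory*, LNM 1673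
  (1997), Thm. 1.11; [SpringerLAG1998] T. A. Springer, *Linear Algebraic Groups* (1998), Thm. 5.5.5
  (through `SLOrbitMapQuotient.lean`).

## Provenance

Cell `val-lit`, seat `val-lit-t02` generation 6 (registry claim `MS08_thm_1_8a`).
-/

noncomputable section

open MvPolynomial Representation
open scoped Matrix
open Literature.NumberTheory.Automorphic (GLCoord glCoordFun)
open Literature.NumberTheory.DiophantineGeometry (IsRationalRep)
open Literature.RepresentationTheory.AlgebraicGroups (isSemisimpleRepresentation_specialLinear)

namespace Literature.Computability.AlgebraicComplexity

universe u

/-! ### § 1 Coinvariants from invariants on a completely reducible module -/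

section Coinvariants

variable {G : Type*} [Group G] {V : Type u} [AddCommGroup V] [Module ℂ V]

/-- `IsCompl` of subrepresentations gives `IsCompl` of the underlying submodules. [folklore] -/
private theorem isCompl_toSubmodule_of_isCompl'' {τ : Representation ℂ G V}
    {T T' : Subrepresentation τ} (h : IsCompl T T') : IsCompl T.toSubmodule T'.toSubmodule := by
  rw [isCompl_iff, disjoint_iff, codisjoint_iff] at h ⊢
  exact ⟨by rw [← Subrepresentation.toSubmodule_inf, h.1]; rfl,
    by rw [← Subrepresentation.toSubmodule_sup, h.2]; rfl⟩

/-- **Coinvariants from invariants** (Mulmuley–Sohoni 2008, Def. 4.1 `[L1014–1018]`: «if `H` is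
reductive, `M` contains an `H`-invariant iff `M^*` does»; used in the proof of Prop. 5.2): on a
completely reducible `τ` a non-zero invariant vector gives a non-zero invariant linear functional —
a functional through the projection onto the invariants along a `τ`-stable complement.
[cite: MulmuleySohoniGCT2SIAM2008, Def. 4.1 (arXiv cs/0612134 Def. 5.1, main.tex L1014–1018)] -/
theorem exists_invariant_functional_of_invariant (τ : Representation ℂ G V)
    (hss : τ.IsSemisimpleRepresentation) {u : V} (hu0 : u ≠ 0) (hu : ∀ g : G, τ g u = u) :
    ∃ φ : V →ₗ[ℂ] ℂ, φ u ≠ 0 ∧ ∀ (g : G) (x : V), φ (τ g x) = φ x := by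
  classical
  -- the invariants as a subrepresentation, and a stable complement
  let I : Subrepresentation τ :=
    ⟨τ.invariants, fun g v hv => by
      rw [Representation.mem_invariants] at hv ⊢
      intro g'
      rw [hv, hv]⟩
  obtain ⟨C, hIC⟩ := hss.exists_isCompl I
  have hIC' : IsCompl τ.invariants C.toSubmodule := isCompl_toSubmodule_of_isCompl'' hIC
  -- a functional on `V` non-zero at `u`, composed with the projection onto `I` along `C`
  obtain ⟨φ₀, hφ₀⟩ : ∃ φ₀ : V →ₗ[ℂ] ℂ, φ₀ u ≠ 0 := by
    by_contra hall
    push Not at hall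
    exact hu0 ((Module.forall_dual_apply_eq_zero_iff ℂ u).mp hall)
  let P : V →ₗ[ℂ] V := τ.invariants.subtype ∘ₗ Submodule.projectionOnto τ.invariants C.toSubmodule hIC'
  have hPa : ∀ {y : V} (hy : y ∈ τ.invariants), P y = y := fun {y} hy => by
    change ((Submodule.projectionOnto τ.invariants C.toSubmodule hIC' y : τ.invariants) : V) = y
    rw [Submodule.projectionOnto_apply_of_mem_left hIC' hy]
  have hPc : ∀ {y : V} (hy : y ∈ C.toSubmodule), P y = 0 := fun {y} hy => by
    change ((Submodule.projectionOnto τ.invariants C.toSubmodule hIC' y : τ.invariants) : V) = 0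
    rw [Submodule.projectionOnto_apply_of_mem_right hIC' hy]
    rfl
  refine ⟨φ₀ ∘ₗ P, ?_, fun g x => ?_⟩
  · have huI : u ∈ τ.invariants := (Representation.mem_invariants τ u).mpr hu
    change φ₀ (P u) ≠ 0
    rwa [hPa huI]
  · change φ₀ (P (τ g x)) = φ₀ (P x)
    -- decompose `x = a + c`
    obtain ⟨a, ha, c, hc, rfl⟩ :=
      Submodule.mem_sup.mp (hIC'.sup_eq_top.symm ▸ Submodule.mem_top (x := x))
    have hga : τ g a = a := (Representation.mem_invariants τ a).mp ha g
    simp only [map_add, hga, hPa ha, hPc hc, hPc (C.apply_mem_toSubmodule g hc)]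

end Coinvariants

/-! ### § 2–§ 4 Prop. 5.2 and Thm. 1.8 (a) from the orbit-map quotient theorem -/

section Prop52

variable {σ : Type} [Fintype σ] [LinearOrder σ]

/-- Equivariance of evaluation along the `SL`-orbit: `(γ · F)(s · v) = F((γ⁻¹ s) · v)`
(the tree's `aeval_formCoeff_coordSubst`, for elements of `slSubgroup`). [folklore] -/
private theorem aeval_formCoeff_coordSubst_sl (v : MvPolynomial σ ℂ) (m : ℕ)
    (γ s : ↥(slSubgroup σ ℂ)) (F : MvPolynomial (DegIdx σ m) ℂ) :
    aeval (formCoeff m (linSubstRep σ ℂ (s : GL σ ℂ) v)) (coordSubst m (γ : GL σ ℂ) F) =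
      aeval (formCoeff m (linSubstRep σ ℂ ((γ⁻¹ * s : ↥(slSubgroup σ ℂ)) : GL σ ℂ) v)) F := by
  rw [aeval_formCoeff_coordSubst, ← Module.End.mul_apply, ← map_mul, Subgroup.coe_mul,
    Subgroup.coe_inv]

/-- A class in `ℂ[Δ[v]]` that vanishes gives a function vanishing along the `SL`-orbit. [folklore] -/
private theorem aeval_formCoeff_eq_zero_of_mk_eq_zero {v : MvPolynomial σ ℂ} {m : ℕ}
    {F : MvPolynomial (DegIdx σ m) ℂ}
    (hF : Ideal.Quotient.mk (orbitVanishingIdeal v m) F = 0) (s : ↥(slSubgroup σ ℂ)) :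
    aeval (formCoeff m (linSubstRep σ ℂ (s : GL σ ℂ) v)) F = 0 := by
  rw [Ideal.Quotient.eq_zero_iff_mem, mem_orbitVanishingIdeal_iff] at hF
  exact hF _

/-- `coordSubst` preserves `totalDegree ≤ D` (it preserves each homogeneous component's degree).
[folklore] -/
private theorem coordSubst_mem_restrictTotalDegree {m D : ℕ} (γ : GL σ ℂ)
    {F : MvPolynomial (DegIdx σ m) ℂ} (hF : F ∈ restrictTotalDegree (DegIdx σ m) ℂ D) :
    coordSubst m γ F ∈ restrictTotalDegree (DegIdx σ m) ℂ D := by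
  classical
  rw [mem_restrictTotalDegree] at hF ⊢
  conv_lhs => rw [← sum_homogeneousComponent F]
  rw [map_sum]
  refine (totalDegree_finsetSum _ _).trans (Finset.sup_le fun d hd => ?_)
  have hd' : d ≤ D := (Nat.lt_succ_iff.mp (Finset.mem_range.mp hd)).trans hF
  exact (isHomogeneous_coordSubst γ (homogeneousComponent_isHomogeneous d F)).totalDegree_le.trans hd'

/-- `coordSubst` commutes with taking homogeneous components. [folklore] -/
private theorem homogeneousComponent_coordSubst {m : ℕ} (γ : GL σ ℂ)
    (F : MvPolynomial (DegIdx σ m) ℂ) (d : ℕ) :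
    homogeneousComponent d (coordSubst m γ F) = coordSubst m γ (homogeneousComponent d F) := by
  classical
  conv_lhs => rw [← sum_homogeneousComponent F, map_sum]
  rw [map_sum]  -- `homogeneousComponent d` is linear
  have hterm : ∀ e : ℕ, homogeneousComponent d (coordSubst m γ (homogeneousComponent e F)) =
      if d = e then coordSubst m γ (homogeneousComponent e F) else 0 := fun e =>
    homogeneousComponent_of_mem
      (isHomogeneous_coordSubst γ (homogeneousComponent_isHomogeneous e F))
  simp_rw [hterm]
  rw [Finset.sum_ite_eq]
  split_ifs with hd
  · rfl
  · rw [Finset.mem_range, not_lt] at hd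
    rw [homogeneousComponent_eq_zero _ _ (Nat.lt_of_succ_le hd), map_zero]

/-- **Mulmuley–Sohoni 2008, Prop. 5.2 from the orbit-map quotient theorem** `[tex:cs_0612134
main.tex L1119–1168]` («Suppose `h ∈ P(V)` is stable. Then every `H`-admissible, irreducible
`G`-module occurs in `R[h]`»; printed proof: Matsushima, `G ĥ ≅ G/H` [mumford], algebraic
Peter–Weyl, the equivariant surjection `R[h] → ℂ[G ĥ]`), in the binders of the named fact
`MS08_thm_1_8a` (`G = SL_σ(ℂ)`, `V = Sym^m ℂ^σ`, `v` polystable; irreducibility of the module is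
not used), ASSUMING the orbit-map quotient theorem for closed `SL`-orbits of forms
(`Grosshans1997_thm_1_11_slOrbit_forms`, `SLOrbitMapQuotient.lean`). Proof: § 1–§ 3 of the module
docstring.
[cite: MulmuleySohoniGCT2SIAM2008, Prop. 5.2 (arXiv cs/0612134 Prop. 6.2, main.tex L1119–1168)] -/
theorem MS08_prop_5_2_of_orbitQuotient (horb : Grosshans1997_thm_1_11_slOrbit_forms)
    (v : MvPolynomial σ ℂ) {m : ℕ} (hv : v.IsHomogeneous m) (hst : IsPolystable v)
    {V : Type} [AddCommGroup V] [Module ℂ V] [FiniteDimensional ℂ V]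
    (ρ : Representation ℂ (GL σ ℂ) V) (hρ : IsRationalRep ρ)
    (hadm : IsAdmissible ρ (slSubgroup σ ℂ ⊓ linStabilizer v)) :
    ∃ d : ℕ, ∃ ψ : IntertwiningMap (ρ.comp (slSubgroup σ ℂ).subtype)
        ((orbitCoordRepDeg v m d).comp (slSubgroup σ ℂ).subtype), ψ ≠ 0 := by
  classical
  set H : Subgroup (GL σ ℂ) := slSubgroup σ ℂ ⊓ linStabilizer v with hHdef
  set SL : Subgroup (GL σ ℂ) := slSubgroup σ ℂ with hSLdef
  -- evaluation along the orbit: `E F = (s ↦ F(s · v))`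
  let E : MvPolynomial (DegIdx σ m) ℂ →ₗ[ℂ] (↥SL → ℂ) :=
    { toFun := fun F s => aeval (formCoeff m (linSubstRep σ ℂ (s : GL σ ℂ) v)) F
      map_add' := fun F G => by funext s; simp only [map_add, Pi.add_apply]
      map_smul' := fun a F => by
        funext s; simp only [map_smul, smul_eq_mul, Pi.smul_apply, RingHom.id_apply] }
  have hE_apply : ∀ F s, E F s = aeval (formCoeff m (linSubstRep σ ℂ (s : GL σ ℂ) v)) F :=
    fun F s => rfl
  have hE_coordSubst : ∀ (γ s : ↥SL) (F : MvPolynomial (DegIdx σ m) ℂ),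
      E (coordSubst m (γ : GL σ ℂ) F) s = E F (γ⁻¹ * s) := fun γ s F => by
    rw [hE_apply, hE_apply]; exact aeval_formCoeff_coordSubst_sl v m γ s F
  -- § 1: an `H`-invariant functional `u'` that is non-zero
  obtain ⟨u, hu0, hu⟩ := isAdmissible_iff_exists.mp hadm
  have hssH : Representation.IsSemisimpleRepresentation (ρ.comp H.subtype) :=
    isSemisimpleRepresentation_comp_stabilizer_of_isPolystable hv hst ρ hρ
  obtain ⟨u', hu'0, hu'⟩ := exists_invariant_functional_of_invariant (ρ.comp H.subtype) hssH hu0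
    (fun g => hu g g.2)
  have hu'inv : ∀ γ ∈ H, ∀ x, u' (ρ γ x) = u' x := fun γ hγ x => hu' ⟨γ, hγ⟩ x
  -- § 2: the matrix coefficients `c_x : s ↦ u'(ρ(s)⁻¹ x)` on `SL`
  let c : V →ₗ[ℂ] (↥SL → ℂ) :=
    { toFun := fun x s => u' (ρ (s : GL σ ℂ)⁻¹ x)
      map_add' := fun x y => by funext s; simp only [map_add, Pi.add_apply]
      map_smul' := fun a x => by
        funext s; simp only [map_smul, smul_eq_mul, Pi.smul_apply, RingHom.id_apply] }
  have hc_apply : ∀ x s, c x s = u' (ρ (s : GL σ ℂ)⁻¹ x) := fun x s => rfl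
  have hc_equiv : ∀ (γ s : ↥SL) (x : V), c (ρ γ x) s = c x (γ⁻¹ * s) := by
    intro γ s x
    rw [hc_apply, hc_apply, ← Module.End.mul_apply, ← map_mul]
    congr 2
  -- each `c_x` is polynomial in the matrix entries and right-`H`-invariant, hence (quotient
  -- theorem) of the form `s ↦ F(s · v)`
  have hcF : ∀ x : V, ∃ F : MvPolynomial (DegIdx σ m) ℂ, c x = E F := by
    intro x
    obtain ⟨P, r, hP⟩ := hρ x u'
    -- `f(g) = P(adj g)`: on `SL`, `u'(ρ(g⁻¹) x) = P(g⁻¹) = P(adj g)`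
    set f : MvPolynomial (σ × σ) ℂ :=
      bind₁ (fun ij : σ × σ => (Matrix.mvPolynomialX σ σ ℂ).adjugate ij.1 ij.2) P with hfdef
    have hf : ∀ (γ : GL σ ℂ), Matrix.det (γ : Matrix σ σ ℂ) = 1 →
        MvPolynomial.eval (fun ij : σ × σ => (γ : Matrix σ σ ℂ) ij.1 ij.2) f = u' (ρ γ⁻¹ x) := by
      intro γ hγ
      have hdetinv : Matrix.det ((γ⁻¹ : GL σ ℂ) : Matrix σ σ ℂ) = 1 := by
        have h := congrArg (fun g : GL σ ℂ => Matrix.det (g : Matrix σ σ ℂ)) (inv_mul_cancel γ)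
        simp only [Units.val_mul, Matrix.det_mul, Units.val_one, Matrix.det_one, hγ, mul_one] at h
        exact h
      have hP' := hP γ⁻¹
      rw [hdetinv, one_pow, mul_one] at hP'
      rw [hP', hfdef]
      change MvPolynomial.eval _ (bind₁ _ P) = _
      rw [show MvPolynomial.eval (fun ij : σ × σ => (γ : Matrix σ σ ℂ) ij.1 ij.2) =
          (aeval (fun ij : σ × σ => (γ : Matrix σ σ ℂ) ij.1 ij.2) :
            MvPolynomial (σ × σ) ℂ →ₐ[ℂ] ℂ).toRingHom from rfl]
      rw [AlgHom.toRingHom_eq_coe, AlgHom.coe_toRingHom, aeval_bind₁]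
      -- the adjugate of the generic matrix evaluates to the adjugate
      have hadj : (fun ij : σ × σ => aeval (fun ij : σ × σ => (γ : Matrix σ σ ℂ) ij.1 ij.2)
          ((Matrix.mvPolynomialX σ σ ℂ).adjugate ij.1 ij.2)) =
          fun ij : σ × σ => ((γ⁻¹ : GL σ ℂ) : Matrix σ σ ℂ) ij.1 ij.2 := by
        funext ij
        have h1 : (MvPolynomial.eval fun p : σ × σ => (γ : Matrix σ σ ℂ) p.1 p.2).mapMatrix
            (Matrix.mvPolynomialX σ σ ℂ).adjugate = (γ : Matrix σ σ ℂ).adjugate := by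
          rw [RingHom.map_adjugate, Matrix.mvPolynomialX_mapMatrix_eval]
        have h2 := congrFun (congrFun h1 ij.1) ij.2
        rw [RingHom.mapMatrix_apply, Matrix.map_apply] at h2
        rw [show (aeval (fun ij : σ × σ => (γ : Matrix σ σ ℂ) ij.1 ij.2) :
              MvPolynomial (σ × σ) ℂ →ₐ[ℂ] ℂ) ((Matrix.mvPolynomialX σ σ ℂ).adjugate ij.1 ij.2) =
            MvPolynomial.eval (fun ij : σ × σ => (γ : Matrix σ σ ℂ) ij.1 ij.2)
              ((Matrix.mvPolynomialX σ σ ℂ).adjugate ij.1 ij.2) from rfl,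
          h2, Matrix.coe_units_inv, Matrix.inv_def, Ring.inverse_eq_inv', hγ, inv_one, one_smul]
      rw [hadj]
      rfl
    have hfinv : ∀ g h : Matrix σ σ ℂ, g.det = 1 → h.det = 1 → linSubst σ ℂ h v = v →
        MvPolynomial.eval (fun ij : σ × σ => (g * h) ij.1 ij.2) f =
          MvPolynomial.eval (fun ij : σ × σ => g ij.1 ij.2) f := by
      intro g h hg hh hhv
      have hg0 : g.det ≠ 0 := by rw [hg]; exact one_ne_zero
      have hh0 : h.det ≠ 0 := by rw [hh]; exact one_ne_zero
      set G : GL σ ℂ := Matrix.GeneralLinearGroup.mkOfDetNeZero g hg0 with hGdef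
      set Hm : GL σ ℂ := Matrix.GeneralLinearGroup.mkOfDetNeZero h hh0 with hHmdef
      have hGH : ((G * Hm : GL σ ℂ) : Matrix σ σ ℂ) = g * h := by rw [Units.val_mul]; rfl
      have hHmem : Hm⁻¹ ∈ H := by
        refine H.inv_mem (Subgroup.mem_inf.mpr ⟨mem_slSubgroup_iff.mpr hh, ?_⟩)
        rw [mem_linStabilizer, linSubstRep_apply]
        exact hhv
      rw [show (fun ij : σ × σ => (g * h) ij.1 ij.2) =
          fun ij : σ × σ => ((G * Hm : GL σ ℂ) : Matrix σ σ ℂ) ij.1 ij.2 by rw [hGH],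
        hf (G * Hm) (by rw [hGH, Matrix.det_mul, hg, hh, mul_one]),
        show (fun ij : σ × σ => g ij.1 ij.2) = fun ij : σ × σ => (G : Matrix σ σ ℂ) ij.1 ij.2 from rfl,
        hf G hg, mul_inv_rev, map_mul, Module.End.mul_apply, hu'inv _ hHmem]
    obtain ⟨F, hF⟩ := horb v hv hst f hfinv
    refine ⟨F, funext fun s => ?_⟩
    have hs : Matrix.det ((s : GL σ ℂ) : Matrix σ σ ℂ) = 1 := mem_slSubgroup_iff.mp s.2
    rw [hc_apply, hE_apply, linSubstRep_apply, ← hF _ hs, hf _ hs]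
  -- § 3: a degree bound `D` and the finite-dimensional `SL`-module `W = ℂ[Sym^m]_{≤D}`
  choose Fx hFx using hcF
  let b := Module.finBasis ℂ V
  set D : ℕ := Finset.univ.sup fun i => (Fx (b i)).totalDegree with hDdef
  let L₀ : V →ₗ[ℂ] MvPolynomial (DegIdx σ m) ℂ := ∑ i, (b.coord i).smulRight (Fx (b i))
  have hL₀_apply : ∀ x, L₀ x = ∑ i, b.coord i x • Fx (b i) := fun x => by
    simp only [L₀, LinearMap.sum_apply, LinearMap.smulRight_apply]
  have hL₀c : ∀ x, E (L₀ x) = c x := by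
    intro x
    calc E (L₀ x) = ∑ i, b.coord i x • c (b i) := by
          rw [hL₀_apply, map_sum]
          exact Finset.sum_congr rfl fun i _ => by rw [map_smul, hFx]
      _ = c (∑ i, b.coord i x • b i) := by
          rw [map_sum]
          exact Finset.sum_congr rfl fun i _ => by rw [map_smul]
      _ = c x := by simp_rw [Module.Basis.coord_apply]; rw [b.sum_repr]
  have hL₀W : ∀ x, L₀ x ∈ restrictTotalDegree (DegIdx σ m) ℂ D := by
    intro x
    rw [hL₀_apply]
    refine Submodule.sum_mem _ fun i _ => Submodule.smul_mem _ _ ?_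
    rw [mem_restrictTotalDegree]
    exact Finset.le_sup (f := fun i => (Fx (b i)).totalDegree) (Finset.mem_univ i)
  -- `W = ℂ[Sym^m]_{≤D}` as an `SL`-subrepresentation of `coordRep`, completely reducible
  let W : Subrepresentation ((coordRep σ ℂ m).comp SL.subtype) :=
    ⟨restrictTotalDegree (DegIdx σ m) ℂ D, fun γ F hF =>
      coordSubst_mem_restrictTotalDegree (γ : GL σ ℂ) hF⟩
  let τ := W.toRepresentation
  have hτ_coe : ∀ (γ : ↥SL) (w : W.toSubmodule),
      ((τ γ w : W.toSubmodule) : MvPolynomial (DegIdx σ m) ℂ) =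
        coordSubst m (γ : GL σ ℂ) (w : MvPolynomial (DegIdx σ m) ℂ) := fun γ w => rfl
  haveI : FiniteDimensional ℂ W.toSubmodule :=
    show Module.Finite ℂ (restrictTotalDegree (DegIdx σ m) ℂ D) from inferInstance
  have hτreg : ∀ (w : W.toSubmodule) (ℓ : Module.Dual ℂ W.toSubmodule),
      ∃ P : MvPolynomial (GLCoord σ) ℂ,
        ∀ g : ↥SL, ℓ (τ g w) = MvPolynomial.eval (glCoordFun (g : GL σ ℂ)) P := by
    intro w ℓ
    set ℓ' : Module.Dual ℂ (MvPolynomial (DegIdx σ m) ℂ) :=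
      Subspace.dualLift (restrictTotalDegree (DegIdx σ m) ℂ D) ℓ with hℓ'
    obtain ⟨P, r, hP⟩ :=
      isRationalRep_coordRep (σ := σ) (k := ℂ) m (w : MvPolynomial (DegIdx σ m) ℂ) ℓ'
    refine ⟨rename Sum.inl P * X (Sum.inr ()) ^ r, fun g => ?_⟩
    have hdet : Matrix.det ((g : GL σ ℂ) : Matrix σ σ ℂ) ≠ 0 :=
      ((Matrix.isUnit_iff_isUnit_det _).mp (g : GL σ ℂ).isUnit).ne_zero
    have hcomp : (glCoordFun (g : GL σ ℂ) ∘ Sum.inl) =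
        fun ij : σ × σ => ((g : GL σ ℂ) : Matrix σ σ ℂ) ij.1 ij.2 := by
      funext ij; rfl
    have h1 : ℓ (τ g w) = ℓ' (coordRep σ ℂ m (g : GL σ ℂ) (w : MvPolynomial (DegIdx σ m) ℂ)) := by
      rw [hℓ', coordRep_apply, ← hτ_coe, Subspace.dualLift_of_subtype]
    rw [map_mul, map_pow, eval_X, Literature.NumberTheory.Automorphic.glCoordFun_inr, eval_rename,
      hcomp, ← hP (g : GL σ ℂ), h1, mul_assoc, ← mul_pow, mul_inv_cancel₀ hdet, one_pow, mul_one]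
  have hτss : τ.IsSemisimpleRepresentation :=
    isSemisimpleRepresentation_specialLinear (M := SL) (fun g => mem_slSubgroup_iff) τ hτreg
  -- the kernel of `E` on `W` and an `SL`-stable complement `W'`
  let K : Subrepresentation τ :=
    ⟨LinearMap.ker ((E).comp W.toSubmodule.subtype), fun γ w hw => by
      rw [LinearMap.mem_ker] at hw ⊢
      change E ((τ γ w : W.toSubmodule) : MvPolynomial (DegIdx σ m) ℂ) = 0
      rw [hτ_coe]
      funext s
      rw [hE_coordSubst, show E (w : MvPolynomial (DegIdx σ m) ℂ) = 0 from hw]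
      rfl⟩
  have hKmem : ∀ w : W.toSubmodule, w ∈ K.toSubmodule ↔
      E (w : MvPolynomial (DegIdx σ m) ℂ) = 0 := fun w => LinearMap.mem_ker
  obtain ⟨W', hKW'⟩ := hτss.exists_isCompl K
  have hKW'' : IsCompl K.toSubmodule W'.toSubmodule := isCompl_toSubmodule_of_isCompl'' hKW'
  -- injectivity of `E` on `W'`
  have hinjW' : ∀ a b : W.toSubmodule, a ∈ W'.toSubmodule → b ∈ W'.toSubmodule →
      E (a : MvPolynomial (DegIdx σ m) ℂ) = E (b : MvPolynomial _ ℂ) →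
      a = b := by
    intro a b ha hb hab
    have hK : a - b ∈ K.toSubmodule := by
      rw [hKmem, Submodule.coe_sub, map_sub, hab, sub_self]
    have hW'm : a - b ∈ W'.toSubmodule := W'.toSubmodule.sub_mem ha hb
    have : a - b ∈ K.toSubmodule ⊓ W'.toSubmodule := ⟨hK, hW'm⟩
    rw [hKW''.inf_eq_bot, Submodule.mem_bot, sub_eq_zero] at this
    exact this
  -- the equivariant lift `L : V → W' ⊆ ℂ[Sym^m]`
  have hdecomp : ∀ w : W.toSubmodule, ∃ k ∈ K.toSubmodule, ∃ w' ∈ W'.toSubmodule, k + w' = w :=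
    fun w => Submodule.mem_sup.mp (hKW''.sup_eq_top.symm ▸ Submodule.mem_top)
  choose kpart hkpart wpart hwpart hsum using hdecomp
  -- the projection onto `W'` along `K`, as a linear map (characterised by `hdecomp`)
  let q : W.toSubmodule →ₗ[ℂ] W.toSubmodule :=
    W'.toSubmodule.subtype ∘ₗ Submodule.projectionOnto W'.toSubmodule K.toSubmodule hKW''.symm
  have hq_mem : ∀ w, q w ∈ W'.toSubmodule := fun w =>
    (Submodule.projectionOnto W'.toSubmodule K.toSubmodule hKW''.symm w).2
  have hq_eval : ∀ w : W.toSubmodule, E ((q w : W.toSubmodule) : MvPolynomial _ ℂ) =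
      E (w : MvPolynomial (DegIdx σ m) ℂ) := by
    intro w
    have hqw : q w = wpart w := by
      change ((Submodule.projectionOnto W'.toSubmodule K.toSubmodule hKW''.symm w :
        W'.toSubmodule) : W.toSubmodule) = wpart w
      conv_lhs => rw [← hsum w]
      rw [map_add, Submodule.projectionOnto_apply_of_mem_right hKW''.symm (hkpart w),
        Submodule.projectionOnto_apply_of_mem_left hKW''.symm (hwpart w), zero_add]
    have hk : E ((kpart w : W.toSubmodule) : MvPolynomial _ ℂ) = 0 :=
      (hKmem _).mp (hkpart w)
    rw [hqw]
    conv_rhs => rw [← hsum w, Submodule.coe_add, map_add, hk, zero_add]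
  let L : V →ₗ[ℂ] MvPolynomial (DegIdx σ m) ℂ :=
    W.toSubmodule.subtype ∘ₗ q ∘ₗ LinearMap.codRestrict W.toSubmodule L₀ hL₀W
  have hL_apply : ∀ x, L x = ((q ⟨L₀ x, hL₀W x⟩ : W.toSubmodule) : MvPolynomial _ ℂ) := fun x => rfl
  have hLc : ∀ x, E (L x) = c x := fun x => by
    rw [hL_apply, hq_eval]; exact hL₀c x
  have hLequiv : ∀ (γ : ↥SL) (x : V), L (ρ (γ : GL σ ℂ) x) = coordSubst m (γ : GL σ ℂ) (L x) := by
    intro γ x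
    have ha : q ⟨L₀ (ρ (γ : GL σ ℂ) x), hL₀W _⟩ ∈ W'.toSubmodule := hq_mem _
    have hb : τ γ (q ⟨L₀ x, hL₀W x⟩) ∈ W'.toSubmodule := W'.apply_mem_toSubmodule γ (hq_mem _)
    have heq := hinjW' _ _ ha hb (by
      funext s
      calc E ((q ⟨L₀ (ρ (γ : GL σ ℂ) x), hL₀W _⟩ : W.toSubmodule) :
              MvPolynomial (DegIdx σ m) ℂ) s
          = c (ρ (γ : GL σ ℂ) x) s := by rw [← hL_apply, hLc]
        _ = c x (γ⁻¹ * s) := hc_equiv γ s x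
        _ = E (L x) (γ⁻¹ * s) := by rw [hLc]
        _ = E (coordSubst m (γ : GL σ ℂ) (L x)) s := (hE_coordSubst γ s (L x)).symm
        _ = E ((τ γ (q ⟨L₀ x, hL₀W x⟩) : W.toSubmodule) :
              MvPolynomial (DegIdx σ m) ℂ) s := by rw [hτ_coe, hL_apply])
    rw [hL_apply, heq, hτ_coe, ← hL_apply]
  -- the degree-`d` intertwiners `ψ_d : x ↦ [L(x)_d] ∈ ℂ[Δ[v]]_d`
  let ℓ : ℕ → V →ₗ[ℂ] OrbitCoordRing v m := fun d =>
    (Ideal.Quotient.mkₐ ℂ (orbitVanishingIdeal v m)).toLinearMap ∘ₗ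
      (homogeneousComponent d : MvPolynomial (DegIdx σ m) ℂ →ₗ[ℂ] MvPolynomial (DegIdx σ m) ℂ) ∘ₗ L
  have hℓ_apply : ∀ d x, ℓ d x =
      Ideal.Quotient.mk (orbitVanishingIdeal v m) (homogeneousComponent d (L x)) := fun d x => rfl
  have hℓ_mem : ∀ d x, ℓ d x ∈ orbitCoordRingDeg v m d := fun d x =>
    mem_orbitCoordRingDeg_iff.mpr ⟨_, homogeneousComponent_isHomogeneous d (L x), rfl⟩
  let ψ : ∀ d : ℕ, IntertwiningMap (ρ.comp SL.subtype) ((orbitCoordRepDeg v m d).comp SL.subtype) :=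
    fun d =>
    { toLinearMap := LinearMap.codRestrict (orbitCoordRingDeg v m d) (ℓ d) (hℓ_mem d)
      isIntertwining' := fun γ => by
        apply LinearMap.ext
        intro x
        apply Subtype.ext
        change ℓ d (ρ (γ : GL σ ℂ) x) = orbitCoordRep v m (γ : GL σ ℂ) (ℓ d x)
        rw [hℓ_apply, hℓ_apply, hLequiv, homogeneousComponent_coordSubst, orbitCoordRep_apply,
          orbitCoordSubst_mk] }
  have hψ_apply : ∀ d x, ((ψ d x : orbitCoordRingDeg v m d) : OrbitCoordRing v m) = ℓ d x :=
    fun d x => rfl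
  -- some `ψ_d` is non-zero
  by_contra hnone
  push Not at hnone
  have hzero : ∀ d x, E (homogeneousComponent d (L x)) = 0 := by
    intro d x
    funext s
    rw [hE_apply]
    refine aeval_formCoeff_eq_zero_of_mk_eq_zero ?_ s
    rw [← hℓ_apply, ← hψ_apply, hnone d (ψ d)]
    rfl
  have hcx : ∀ x, c x = 0 := by
    intro x
    rw [← hLc x]
    conv_lhs => rw [← sum_homogeneousComponent (L x)]
    rw [map_sum]
    exact Finset.sum_eq_zero fun d _ => hzero d x
  apply hu'0
  have h := congrFun (hcx u) 1
  rw [hc_apply, Pi.zero_apply, Subgroup.coe_one, inv_one, map_one, Module.End.one_apply] at h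
  exact h

open Literature.NumberTheory.DiophantineGeometry in
/-- **Mulmuley–Sohoni 2008, Thm. 1.8 (a) from the orbit-map quotient theorem.** The named fact
`MS08_thm_1_8a` (Borel–Weil for orbit closures of stable points, part (a), in the tree's special
case `G = SL_σ(ℂ)`, `V = Sym^m ℂ^σ`; main.tex L478–487) follows from the single classical fact
`Grosshans1997_thm_1_11_slOrbit_forms` (the orbit map of a closed `SL`-orbit of
forms is a quotient by the stabiliser): «only if» = `MS08_thm_1_8a_mp` (Prop. 5.1 + Matsushima for
forms, unconditional), «if» = `MS08_prop_5_2_of_orbitQuotient`.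
[cite: MulmuleySohoniGCT2SIAM2008, Thm. 1.8 (a) (arXiv cs/0612134 Thm. 2.8 (a); main.tex L478–487, L1169–1173)] -/
theorem MS08_thm_1_8a_of_orbitQuotient (horb : Grosshans1997_thm_1_11_slOrbit_forms) :
    MS08_thm_1_8a :=
  MS08_thm_1_8a_of_prop_5_2 fun v _ _ hv _ hst _ _ _ _ ρ hρ _ hadm =>
    MS08_prop_5_2_of_orbitQuotient horb v hv hst ρ hρ hadm

end Prop52

/-! ## Def. 4.1, remark `[L1014–1018]`: invariants versus coinvariants for the stabiliser of a stable form -/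

/-- **Mulmuley–Sohoni 2008, Def. 4.1, remark** `[main.tex L1014–1018]` ("if `H` is reductive, `M`
contains an `H`-invariant iff `M^*` does"), PROVED for the stabiliser `H = SL_σ(ℂ) ∩ G_v̂` of a
polystable form `v` (where "reductive" enters through Matsushima: `ρ|_H` is completely reducible for
every finite-dimensional rational `GL_σ(ℂ)`-module `ρ`,
`isSemisimpleRepresentation_comp_stabilizer_of_isPolystable`): `H`-admissibility (`IsAdmissible`,
a non-zero `H`-invariant vector) is equivalent to dual `H`-admissibility (`IsDualAdmissible`, a
non-zero `H`-invariant functional). The crosswalk of `MS08Obstructions.lean` listed this remark as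
NOT TYPED (Weyl's complete reducibility); for stabilisers of stable forms it is now a theorem.
[cite: MulmuleySohoniGCT2SIAM2008, Def. 4.1 (arXiv cs/0612134 Def. 5.1; main.tex L1014–1018)] -/
theorem isAdmissible_iff_isDualAdmissible_of_isPolystable {σ : Type} [Fintype σ] [LinearOrder σ]
    {v : MvPolynomial σ ℂ} {m : ℕ}
    (hv : v.IsHomogeneous m) (hst : IsPolystable v)
    {V : Type} [AddCommGroup V] [Module ℂ V] [FiniteDimensional ℂ V]
    (ρ : Representation ℂ (GL σ ℂ) V) (hρ : IsRationalRep ρ) :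
    IsAdmissible ρ (slSubgroup σ ℂ ⊓ linStabilizer v) ↔
      IsDualAdmissible (slSubgroup σ ℂ ⊓ linStabilizer v) ρ := by
  set H : Subgroup (GL σ ℂ) := slSubgroup σ ℂ ⊓ linStabilizer v with hHdef
  have hss := isSemisimpleRepresentation_comp_stabilizer_of_isPolystable hv hst ρ hρ
  constructor
  · intro hadm
    obtain ⟨u, hu0, hu⟩ := isAdmissible_iff_exists.mp hadm
    obtain ⟨φ, hφu, hφ⟩ :=
      exists_invariant_functional_of_invariant (ρ.comp H.subtype) hss hu0 fun g => hu g g.2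
    refine ⟨φ, fun h0 => hφu (by rw [h0, LinearMap.zero_apply]), fun h hh => ?_⟩
    ext x
    exact hφ ⟨h, hh⟩ x
  · rintro ⟨φ, hφ0, hφ⟩
    obtain ⟨u, hu0, hu⟩ := exists_ne_zero_invariant_of_invariant_functional (ρ.comp H.subtype)
      hss φ hφ0 fun g x => by
        change φ (ρ (g : GL σ ℂ) x) = φ x
        rw [← LinearMap.comp_apply, hφ _ g.2]
    exact isAdmissible_iff_exists.mpr ⟨u, hu0, fun g hg => hu ⟨g, hg⟩⟩

end Literature.Computability.AlgebraicComplexity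

end
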